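import Mathlib
import HarnessLib
import Summits.HubbardSuperconductivity.HubbardSuperconductivity.Theorems.KLProgrammeKLRegimeEnginePairTransferMemberPHSignedRow

/-!
# Route `KLProgramme` — ENGINE item stmt-HubbardSuperconductivity-20437 `KLRegimeEngineV17F2`, class-#5 STEP (X).3 rows form (row `hQ` of
# `klmd_defect_le_rows_family`, the CROSSED class `RQ`): THE SIGNED CROSSED ROW — partner frequency `ω_{p′} = ω_p − 2π/β` (bosonic transfer
# `q₀ = ∓2π/β`), momentum transfer `q̃ = Q_m − x − y`; kernel product split into its frequency-pinned part (`p ↦ ω₀`, `p′ ↦ −ω₀ = ω_{rev ω₀}`) and a flat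
# remainder; pinned part = two signed soft forward bubbles on the model band with frequency shift (cell gate-hubbard-kl, seat hubbard-kl-k3c2-p2 g17)

Same recipe as `…MemberPHSigned(Row)` (direct class).  New plumbing: the crossed constraint `m_{p′} + 2m₀ + 1 = m_p ∧ k′ = k + Q_m − x − y` (`m₀ = 0`)
collapses the partner sum to the frequency index ONE BELOW (`klmc_sum_ite_crossed_eq`, `klmc_sum_ite_crossed_eq'` for the source sum), the shifted frequency
is `ω_p − 2π/β` (`matsubaraFreq_eq_sub_of_matsubaraInt_succ`), it is unique (`klmc_pred_unique`), and when it does NOT exist the label is the bottom/top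
frequency, which lies outside the slice window for `M ≥ β·4Λₙ₊₁/(2π) + 1` (`klmc_val_eq_zero_of_no_pred`, `klmc_sq_gt_of_val_eq_zero`, `…_top`), so the
slice line vanishes there.

* **`klms_memberPH_crossed_norm_le`** — for ANY kernel `V`, ANY `ε` bounding `‖X((ω_i,k̃),(ω_{i′},k̃′)) − X((ω₀,k̃),(−ω₀,k̃′))‖ ≤ ε` for `m_{i′} + 1 = m_i` on the
  window `ω_i² ≤ (5Λₙ₊₁)²`, with `16π/β ≤ Λₙ₊₁`: `‖S_Q‖ ≤ |βL²|²(‖T_B‖ + ‖T_A‖) + ε·(256/3)(βL²)²/Λ(t)²·Σ_p|Φ_j(t)(p)|‖ĝ_K p‖`, `T_B`/`T_A` the pinned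
  forward bubbles at `(q₀, q̃) = (−2π/β, Q_m−x−y)` / `(+2π/β, −(Q_m−x−y))`;
(The frequency-shifted pinned bubble and the assembled crossed row keyed on lattice kernel data follow in `…MemberPHCrossedSignedRow`.)

Pure composition; nothing about the model's effective action is asserted; nothing asserts (X).3, (c), K3 or superconductivity.
-/

noncomputable section

namespace Summit.HubbardSuperconductivity.HubbardSuperconductivity.Theorems.KLRegimeSplit

set_option linter.dupNamespace false -- summit = problem name (single-conjunct summit), D-0017

open Real Set Finset Complex Literature.MathematicalPhysics.QuantumLattice
open Literature.Probability.LatticeModels hiding torusSupNorm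
open Literature.MathematicalPhysics.QuantumLattice.BandSectorCounting
open Summit.HubbardSuperconductivity.HubbardSuperconductivity.Theorems.KLProgrammeLegKernels
open Summit.HubbardSuperconductivity.HubbardSuperconductivity.Theorems.KLRegimeWick
open Summit.HubbardSuperconductivity.HubbardSuperconductivity.Theorems.TwoPointAssembly
open Summit.HubbardSuperconductivity.HubbardSuperconductivity.Theorems.DispersionFlow
open Summit.HubbardSuperconductivity.HubbardSuperconductivity.Theorems.PerturbedFermiCurve

variable {L M : ℕ} [NeZero L] [NeZero M]

/-! ## §1 The crossed constraint: collapse, shifted frequency, existence in the window -/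

omit [NeZero L] in
/-- The crossed constraint in normal form (`m₀ = 0`). -/
theorem klmc_constraint_iff (Qm x y : TorusSite 2 L) (p p' : FreqMomentum L M) :
    (matsubaraInt M p'.1 + matsubaraInt M (omega0 M) + matsubaraInt M (omega0 M) + 1 = matsubaraInt M p.1 ∧ p'.2 = p.2 + Qm - x - y) ↔
      (matsubaraInt M p'.1 + 1 = matsubaraInt M p.1 ∧ p'.2 = p.2 + (Qm - x - y)) := by
  simp only [matsubaraInt_omega0, add_zero]
  have e : p.2 + Qm - x - y = p.2 + (Qm - x - y) := by abel
  rw [e]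

/-- **Partner collapse (crossed)**: `Σ_{p′} 𝟙[C(p,p′)]·F(p′) = Σ_{i′} 𝟙[m_{i′} + 1 = m_p]·F(i′, k + q̃)`. -/
theorem klmc_sum_ite_crossed_eq {E : Type*} [AddCommMonoid E] (Qm x y : TorusSite 2 L) (p : FreqMomentum L M) (F : FreqMomentum L M → E) :
    (∑ p' : FreqMomentum L M, if matsubaraInt M p'.1 + matsubaraInt M (omega0 M) + matsubaraInt M (omega0 M) + 1 = matsubaraInt M p.1 ∧ p'.2 = p.2 + Qm - x - y
      then F p' else 0) =
      ∑ i' : MatsubaraIdx M, if matsubaraInt M i' + 1 = matsubaraInt M p.1 then F (i', p.2 + (Qm - x - y)) else 0 := by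
  simp_rw [klmc_constraint_iff]
  rw [Fintype.sum_prod_type]
  refine Finset.sum_congr rfl fun i' _ => ?_
  by_cases h : matsubaraInt M i' + 1 = matsubaraInt M p.1
  · simp only [h, true_and, if_true]
    rw [Finset.sum_ite_eq' Finset.univ (p.2 + (Qm - x - y)) (fun k => F (i', k))]
    simp
  · simp [h]

/-- **Source collapse (crossed)**: at fixed `p′`, `Σ_p 𝟙[C(p,p′)]·F(p) = Σ_i 𝟙[m_{p′} + 1 = m_i]·F(i, k′ − q̃)`. -/
theorem klmc_sum_ite_crossed_eq' {E : Type*} [AddCommMonoid E] (Qm x y : TorusSite 2 L) (p' : FreqMomentum L M) (F : FreqMomentum L M → E) :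
    (∑ p : FreqMomentum L M, if matsubaraInt M p'.1 + matsubaraInt M (omega0 M) + matsubaraInt M (omega0 M) + 1 = matsubaraInt M p.1 ∧ p'.2 = p.2 + Qm - x - y
      then F p else 0) =
      ∑ i : MatsubaraIdx M, if matsubaraInt M p'.1 + 1 = matsubaraInt M i then F (i, p'.2 + -(Qm - x - y)) else 0 := by
  simp_rw [klmc_constraint_iff]
  rw [Fintype.sum_prod_type]
  refine Finset.sum_congr rfl fun i _ => ?_
  by_cases h : matsubaraInt M p'.1 + 1 = matsubaraInt M i
  · simp only [h, true_and]
    have e : ∀ k : TorusSite 2 L, (p'.2 = k + (Qm - x - y)) ↔ (k = p'.2 + -(Qm - x - y)) := fun k => by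
      constructor
      · intro hk; rw [hk]; abel
      · intro hk; rw [hk]; abel
    simp_rw [e]
    rw [Finset.sum_ite_eq' Finset.univ (p'.2 + -(Qm - x - y)) (fun k => F (i, k))]
    simp
  · simp [h]

omit [NeZero L] [NeZero M] in
/-- Uniqueness of the frequency one below / one above. -/
theorem klmc_pred_unique {i i' i'' : MatsubaraIdx M} (h' : matsubaraInt M i' + 1 = matsubaraInt M i) (h'' : matsubaraInt M i'' + 1 = matsubaraInt M i) :
    i' = i'' := by
  simp only [matsubaraInt] at h' h''
  exact Fin.ext (by omega)

omit [NeZero L] [NeZero M] in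
/-- A single-valued frequency sum: if `m_{i₀} + 1 = m_i` then `Σ_{i′} 𝟙[m_{i′} + 1 = m_i]·F(i′) = F(i₀)`. -/
theorem klmc_sum_ite_pred_eq {E : Type*} [AddCommMonoid E] {i i₀ : MatsubaraIdx M} (h : matsubaraInt M i₀ + 1 = matsubaraInt M i)
    (F : MatsubaraIdx M → E) : (∑ i' : MatsubaraIdx M, if matsubaraInt M i' + 1 = matsubaraInt M i then F i' else 0) = F i₀ := by
  rw [Finset.sum_eq_single i₀]
  · simp [h]
  · intro i' _ hne
    rw [if_neg]
    intro h'
    exact hne (klmc_pred_unique h' h)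
  · intro hi; exact absurd (Finset.mem_univ _) hi

omit [NeZero L] [NeZero M] in
/-- The same for the source sum: if `m_{i′} + 1 = m_{i₀}` then `Σ_i 𝟙[m_{i′} + 1 = m_i]·F(i) = F(i₀)`. -/
theorem klmc_sum_ite_succ_eq {E : Type*} [AddCommMonoid E] {i' i₀ : MatsubaraIdx M} (h : matsubaraInt M i' + 1 = matsubaraInt M i₀)
    (F : MatsubaraIdx M → E) : (∑ i : MatsubaraIdx M, if matsubaraInt M i' + 1 = matsubaraInt M i then F i else 0) = F i₀ := by
  rw [Finset.sum_eq_single i₀]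
  · simp [h]
  · intro i _ hne
    rw [if_neg]
    intro h'
    apply hne
    simp only [matsubaraInt] at h h'
    exact Fin.ext (by omega)
  · intro hi; exact absurd (Finset.mem_univ _) hi

omit [NeZero L] [NeZero M] in
/-- If no frequency lies one below `i` (resp. above `i′`) the sum vanishes. -/
theorem klmc_sum_ite_pred_eq_zero {E : Type*} [AddCommMonoid E] {i : MatsubaraIdx M} (h : ∀ i' : MatsubaraIdx M, matsubaraInt M i' + 1 ≠ matsubaraInt M i)
    (F : MatsubaraIdx M → E) : (∑ i' : MatsubaraIdx M, if matsubaraInt M i' + 1 = matsubaraInt M i then F i' else 0) = 0 :=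
  Finset.sum_eq_zero fun i' _ => by rw [if_neg (h i')]

omit [NeZero L] [NeZero M] in
/-- **The bottom frequency is outside the slice window**: for `M ≥ β·4Λ/(2π) + 1` (`0 < β`, `0 ≤ Λ`) and `i.val = 0`, `(4Λ)² < ω_i²`. -/
theorem klmc_sq_gt_of_val_eq_zero {β Λ : ℝ} (hβ : 0 < β) (hΛ : 0 ≤ Λ) (hM : β * (4 * Λ) / (2 * Real.pi) + 1 ≤ M) (i : MatsubaraIdx M)
    (hi : i.val = 0) : (4 * Λ) ^ 2 < matsubaraFreq β M i ^ 2 := by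
  have hπ := Real.pi_pos
  have hω : matsubaraFreq β M i = -(Real.pi * (2 * (M : ℝ) - 1) / β) := by
    simp only [matsubaraFreq, matsubaraInt, hi]
    push_cast
    ring
  have h3 : β * (4 * Λ) + 2 * Real.pi ≤ 2 * Real.pi * M := by
    have h := (div_le_iff₀ (by positivity : (0 : ℝ) < 2 * Real.pi)).1 (by linarith [hM] : β * (4 * Λ) / (2 * Real.pi) ≤ (M : ℝ) - 1)
    linarith
  have h4 : 4 * Λ < Real.pi * (2 * (M : ℝ) - 1) / β := by
    rw [lt_div_iff₀ hβ]; nlinarith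
  have h5 : (4 * Λ) ^ 2 < (Real.pi * (2 * (M : ℝ) - 1) / β) ^ 2 := pow_lt_pow_left₀ h4 (by positivity) two_ne_zero
  rw [hω, neg_sq]; exact h5

omit [NeZero L] [NeZero M] in
/-- **The top frequency is outside the slice window**: `i.val = 2M − 1` ⇒ `(4Λ)² < ω_i²`. -/
theorem klmc_sq_gt_of_val_eq_top {β Λ : ℝ} (hβ : 0 < β) (hΛ : 0 ≤ Λ) (hM : β * (4 * Λ) / (2 * Real.pi) + 1 ≤ M) (i : MatsubaraIdx M)
    (hi : i.val = 2 * M - 1) : (4 * Λ) ^ 2 < matsubaraFreq β M i ^ 2 := by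
  have hπ := Real.pi_pos
  have hMpos : 1 ≤ 2 * M := by have := i.isLt; omega
  have hω : matsubaraFreq β M i = Real.pi * (2 * (M : ℝ) - 1) / β := by
    simp only [matsubaraFreq, matsubaraInt, hi]
    push_cast [Nat.cast_sub hMpos]
    ring
  have h3 : β * (4 * Λ) + 2 * Real.pi ≤ 2 * Real.pi * M := by
    have h := (div_le_iff₀ (by positivity : (0 : ℝ) < 2 * Real.pi)).1 (by linarith [hM] : β * (4 * Λ) / (2 * Real.pi) ≤ (M : ℝ) - 1)
    linarith
  have h4 : 4 * Λ < Real.pi * (2 * (M : ℝ) - 1) / β := by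
    rw [lt_div_iff₀ hβ]; nlinarith
  rw [hω]; exact pow_lt_pow_left₀ h4 (by positivity) two_ne_zero

omit [NeZero L] [NeZero M] in
/-- No frequency one below `i` ⇒ `i` is the bottom index. -/
theorem klmc_val_eq_zero_of_no_pred {i : MatsubaraIdx M} (h : ∀ i' : MatsubaraIdx M, matsubaraInt M i' + 1 ≠ matsubaraInt M i) : i.val = 0 := by
  by_contra hne
  have hi := i.isLt
  refine h ⟨i.val - 1, by omega⟩ ?_
  simp only [matsubaraInt]
  push_cast [Nat.cast_sub (show 1 ≤ i.val by omega)]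
  ring

omit [NeZero L] [NeZero M] in
/-- No frequency one above `i′` ⇒ `i′` is the top index. -/
theorem klmc_val_eq_top_of_no_succ {i' : MatsubaraIdx M} (h : ∀ i : MatsubaraIdx M, matsubaraInt M i' + 1 ≠ matsubaraInt M i) : i'.val = 2 * M - 1 := by
  by_contra hne
  have hi := i'.isLt
  refine h ⟨i'.val + 1, by omega⟩ ?_
  simp only [matsubaraInt]
  push_cast
  ring

/-! ## §2 The crossed member row: pinned part + flat remainder -/

variable (β μ : ℝ) (K : TrigPolyC4v)

/-- **THE CROSSED MEMBER ROW `hQ`, KERNEL PRODUCT SPLIT** (see the module docstring).  Hypotheses: `0 < β`, `t ∈ [0,1]`, the weight pins, `0 ≤ ε`,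
`16π/β ≤ Λₙ₊₁` (the bosonic shift is below resolution), `M ≥ β·4Λₙ₊₁/(2π) + 1`, and the flatness of the kernel product in the loop frequencies on the
window `ω_i² ≤ (5Λₙ₊₁)²`. -/
theorem klms_memberPH_crossed_norm_le (hβ : 0 < β) (n : ℕ) {t : ℝ} (ht : t ∈ Icc (0 : ℝ) 1) (hβn : 16 * π / β ≤ klScale klE0 (n + 1))
    (hM : β * (4 * klScale klE0 (n + 1)) / (2 * Real.pi) + 1 ≤ M)
    (Φ : ℕ → ℝ → FreqMomentum L M → ℝ) (hΦ : Φ = fun j t k => (softSymbolCompl L M β μ K (n + 1) j) k + (hubbardCutoffWeightCT L M β μ K (klScale klE0 (n + 1)) k -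
            hubbardCutoffWeightCT L M β μ K (klScale klE0 n + t * (klScale klE0 (n + 1) - klScale klE0 n)) k))
    (Wd : ℝ → FreqMomentum L M → ℝ) (hWd : Wd = fun t k => deriv (fun Λ' : ℝ => hubbardCutoffWeightCT L M β μ K Λ' k) (klScale klE0 n + t * (klScale klE0 (n + 1) - klScale klE0 n)))
    (V : ℕ → ℝ → (Fin 4 → HubbardFieldIdx L M) → ℂ) (j : ℕ) (Qm x y : TorusSite 2 L) {ε : ℝ} (hε : 0 ≤ ε)
    (hflat : ∀ (i i' : MatsubaraIdx M) (k k' : TorusSite 2 L), matsubaraInt M i' + 1 = matsubaraInt M i →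
      matsubaraFreq β M i ^ 2 ≤ (5 * klScale klE0 (n + 1)) ^ 2 →
      ‖V j t ![(((i, k), 0), 1), (((i', k'), 1), 0), (((omega0 M, y), 0), 0), ((((omega0 M).rev, Qm - x), 1), 1)] *
            V j t ![(((i, k), 0), 0), (((i', k'), 1), 1), ((((omega0 M).rev, Qm - y), 1), 0), (((omega0 M, x), 0), 1)] -
          V j t ![(((omega0 M, k), 0), 1), ((((omega0 M).rev, k'), 1), 0), (((omega0 M, y), 0), 0), ((((omega0 M).rev, Qm - x), 1), 1)] *
            V j t ![(((omega0 M, k), 0), 0), ((((omega0 M).rev, k'), 1), 1), ((((omega0 M).rev, Qm - y), 1), 0), (((omega0 M, x), 0), 1)]‖ ≤ ε) :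
    ‖∑ p : FreqMomentum L M, ∑ p' : FreqMomentum L M,
        if matsubaraInt M p'.1 + matsubaraInt M (omega0 M) + matsubaraInt M (omega0 M) + 1 = matsubaraInt M p.1 ∧ p'.2 = p.2 + Qm - x - y then
          ((((((Φ j t p) : ℝ) : ℂ) * (((β * (L : ℝ) ^ 2 : ℝ) : ℂ) * propCT L M β μ K p)) * ((((Wd t p') : ℝ) : ℂ) * (((β * (L : ℝ) ^ 2 : ℝ) : ℂ) * propCT L M β μ K p'))) +
              (((((Wd t p) : ℝ) : ℂ) * (((β * (L : ℝ) ^ 2 : ℝ) : ℂ) * propCT L M β μ K p)) * ((((Φ j t p') : ℝ) : ℂ) * (((β * (L : ℝ) ^ 2 : ℝ) : ℂ) * propCT L M β μ K p')))) *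
            (V j t ![((p, 0), 1), ((p', 1), 0), (((omega0 M, y), 0), 0), ((((omega0 M).rev, Qm - x), 1), 1)] *
              V j t ![((p, 0), 0), ((p', 1), 1), ((((omega0 M).rev, Qm - y), 1), 0), (((omega0 M, x), 0), 1)])
        else 0‖ ≤
      (β * (L : ℝ) ^ 2) ^ 2 *
          (‖∑ p : FreqMomentum L M,
              (V j t ![(((omega0 M, p.2), 0), 1), ((((omega0 M).rev, p.2 + (Qm - x - y)), 1), 0), (((omega0 M, y), 0), 0), ((((omega0 M).rev, Qm - x), 1), 1)] *
                  V j t ![(((omega0 M, p.2), 0), 0), ((((omega0 M).rev, p.2 + (Qm - x - y)), 1), 1), ((((omega0 M).rev, Qm - y), 1), 0), (((omega0 M, x), 0), 1)]) *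
                (klfb_prop (klWdC (klScale klE0 n + t * (klScale klE0 (n + 1) - klScale klE0 n))) (matsubaraFreq β M p.1) (nambuXiCT L μ K p.2) *
                  klfb_prop (klPhiC (klScale klE0 j) (klScale klE0 n + t * (klScale klE0 (n + 1) - klScale klE0 n))) (matsubaraFreq β M p.1 + -(2 * π / β))
                    (nambuXiCT L μ K (p.2 + (Qm - x - y))))‖ +
            ‖∑ p : FreqMomentum L M,
              (V j t ![(((omega0 M, p.2 + -(Qm - x - y)), 0), 1), ((((omega0 M).rev, p.2), 1), 0), (((omega0 M, y), 0), 0), ((((omega0 M).rev, Qm - x), 1), 1)] *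
                  V j t ![(((omega0 M, p.2 + -(Qm - x - y)), 0), 0), ((((omega0 M).rev, p.2), 1), 1), ((((omega0 M).rev, Qm - y), 1), 0), (((omega0 M, x), 0), 1)]) *
                (klfb_prop (klWdC (klScale klE0 n + t * (klScale klE0 (n + 1) - klScale klE0 n))) (matsubaraFreq β M p.1) (nambuXiCT L μ K p.2) *
                  klfb_prop (klPhiC (klScale klE0 j) (klScale klE0 n + t * (klScale klE0 (n + 1) - klScale klE0 n))) (matsubaraFreq β M p.1 + 2 * π / β)
                    (nambuXiCT L μ K (p.2 + -(Qm - x - y))))‖) +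
        ε * (256 / 3 * (β * (L : ℝ) ^ 2) ^ 2 / (klScale klE0 n + t * (klScale klE0 (n + 1) - klScale klE0 n)) ^ 2 *
          ∑ p : FreqMomentum L M, |Φ j t p| * ‖propCT L M β μ K p‖) := by
  set Λt : ℝ := klScale klE0 n + t * (klScale klE0 (n + 1) - klScale klE0 n) with hΛt
  set q : TorusSite 2 L := Qm - x - y with hq
  obtain ⟨hlo, hhi⟩ := scaleAt_mem n ht
  have hΛ1 := klth_klScale_pos (n + 1)
  have hΛpos : 0 < Λt := hΛ1.trans_le hlo
  -- kernel product, pinned copy, lines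
  set X : FreqMomentum L M → FreqMomentum L M → ℂ := fun p p' =>
    V j t ![((p, 0), 1), ((p', 1), 0), (((omega0 M, y), 0), 0), ((((omega0 M).rev, Qm - x), 1), 1)] *
      V j t ![((p, 0), 0), ((p', 1), 1), ((((omega0 M).rev, Qm - y), 1), 0), (((omega0 M, x), 0), 1)] with hX
  set X₀ : TorusSite 2 L → TorusSite 2 L → ℂ := fun k k' =>
    V j t ![(((omega0 M, k), 0), 1), ((((omega0 M).rev, k'), 1), 0), (((omega0 M, y), 0), 0), ((((omega0 M).rev, Qm - x), 1), 1)] *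
      V j t ![(((omega0 M, k), 0), 0), ((((omega0 M).rev, k'), 1), 1), ((((omega0 M).rev, Qm - y), 1), 0), (((omega0 M, x), 0), 1)] with hX₀
  set G : FreqMomentum L M → ℂ := fun p => (((β * (L : ℝ) ^ 2 : ℝ)) : ℂ) * propCT L M β μ K p with hG
  set lW : FreqMomentum L M → ℂ := fun p => (((Wd t p : ℝ)) : ℂ) * G p with hlW
  set lΦ : FreqMomentum L M → ℂ := fun p => (((Φ j t p : ℝ)) : ℂ) * G p with hlΦ
  set ln : FreqMomentum L M → FreqMomentum L M → ℂ := fun p p' => lΦ p * lW p' + lW p * lΦ p' with hln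
  set C : FreqMomentum L M → FreqMomentum L M → Prop := fun p p' =>
    matsubaraInt M p'.1 + matsubaraInt M (omega0 M) + matsubaraInt M (omega0 M) + 1 = matsubaraInt M p.1 ∧ p'.2 = p.2 + Qm - x - y with hC
  -- the summand as `ite C (ln·X₀) + ite C (ln·(X − X₀))`
  have hgoal : (∑ p : FreqMomentum L M, ∑ p' : FreqMomentum L M,
        if matsubaraInt M p'.1 + matsubaraInt M (omega0 M) + matsubaraInt M (omega0 M) + 1 = matsubaraInt M p.1 ∧ p'.2 = p.2 + Qm - x - y then
          ((((((Φ j t p) : ℝ) : ℂ) * (((β * (L : ℝ) ^ 2 : ℝ) : ℂ) * propCT L M β μ K p)) * ((((Wd t p') : ℝ) : ℂ) * (((β * (L : ℝ) ^ 2 : ℝ) : ℂ) * propCT L M β μ K p'))) +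
              (((((Wd t p) : ℝ) : ℂ) * (((β * (L : ℝ) ^ 2 : ℝ) : ℂ) * propCT L M β μ K p)) * ((((Φ j t p') : ℝ) : ℂ) * (((β * (L : ℝ) ^ 2 : ℝ) : ℂ) * propCT L M β μ K p')))) *
            (V j t ![((p, 0), 1), ((p', 1), 0), (((omega0 M, y), 0), 0), ((((omega0 M).rev, Qm - x), 1), 1)] *
              V j t ![((p, 0), 0), ((p', 1), 1), ((((omega0 M).rev, Qm - y), 1), 0), (((omega0 M, x), 0), 1)])
        else 0) =
      (∑ p : FreqMomentum L M, ∑ p' : FreqMomentum L M, if C p p' then ln p p' * X₀ p.2 p'.2 else 0) +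
        ∑ p : FreqMomentum L M, ∑ p' : FreqMomentum L M, if C p p' then ln p p' * (X p p' - X₀ p.2 p'.2) else 0 := by
    rw [← Finset.sum_add_distrib]
    refine Finset.sum_congr rfl fun p _ => ?_
    rw [← Finset.sum_add_distrib]
    refine Finset.sum_congr rfl fun p' _ => ?_
    simp only [hC]
    split_ifs
    · simp only [hln, hlW, hlΦ, hX, hX₀, hG]; ring
    · simp
  rw [hgoal]
  refine (norm_add_le _ _).trans (add_le_add ?_ ?_)
  · ----------------------------------------------------------------- the pinned part
    have hsplit : (∑ p : FreqMomentum L M, ∑ p' : FreqMomentum L M, if C p p' then ln p p' * X₀ p.2 p'.2 else 0) =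
        (∑ p : FreqMomentum L M, lW p * ∑ p' : FreqMomentum L M, if C p p' then lΦ p' * X₀ p.2 p'.2 else 0) +
          ∑ p' : FreqMomentum L M, lW p' * ∑ p : FreqMomentum L M, if C p p' then lΦ p * X₀ p.2 p'.2 else 0 := by
      have e1 : ∀ p p', (if C p p' then ln p p' * X₀ p.2 p'.2 else 0) =
          (if C p p' then lW p * (lΦ p' * X₀ p.2 p'.2) else 0) + (if C p p' then lW p' * (lΦ p * X₀ p.2 p'.2) else 0) := by
        intro p p'; split_ifs
        · simp only [hln]; ring
        · simp
      simp_rw [e1, Finset.sum_add_distrib]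
      congr 1
      · refine Finset.sum_congr rfl fun p _ => ?_
        rw [Finset.mul_sum]
        refine Finset.sum_congr rfl fun p' _ => ?_
        split_ifs <;> simp
      · rw [Finset.sum_comm]
        refine Finset.sum_congr rfl fun p' _ => ?_
        rw [Finset.mul_sum]
        refine Finset.sum_congr rfl fun p _ => ?_
        split_ifs <;> simp
    rw [hsplit]
    -- the model lines
    have hLW : ∀ p : FreqMomentum L M, lW p = (((β * (L : ℝ) ^ 2 : ℝ)) : ℂ) * klfb_prop (klWdC Λt) (matsubaraFreq β M p.1) (nambuXiCT L μ K p.2) := by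
      intro p; simp only [hlW, hG, hWd]; exact klfw_sliceLine_eq μ K hβ.ne' hΛpos.ne' p
    have hLΦ : ∀ p : FreqMomentum L M, lΦ p =
        (((β * (L : ℝ) ^ 2 : ℝ)) : ℂ) * klfb_prop (klPhiC (klScale klE0 j) Λt) (matsubaraFreq β M p.1) (nambuXiCT L μ K p.2) := by
      intro p; simp only [hlΦ, hG, hΦ]; exact klfw_memberLine_eq μ K hβ.ne' n j Λt p
    -- a slice line outside the `4Λₙ₊₁` window vanishes
    have hLW0 : ∀ p : FreqMomentum L M, (4 * klScale klE0 (n + 1)) ^ 2 < matsubaraFreq β M p.1 ^ 2 →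
        klfb_prop (klWdC Λt) (matsubaraFreq β M p.1) (nambuXiCT L μ K p.2) = 0 := by
      intro p hω
      rw [klfw_klfb_prop_eq μ K hβ.ne', klWdC, ← klfw_Wd_eq_klWd β μ K hΛpos.ne' p, klms_Wd_eq_zero_of_freq β μ K n hlo hhi p hω]
      simp
    -- term B: partner collapse to the frequency one below
    have hB : ∀ p : FreqMomentum L M, lW p * (∑ p' : FreqMomentum L M, if C p p' then lΦ p' * X₀ p.2 p'.2 else 0) =
        (((β * (L : ℝ) ^ 2 : ℝ)) : ℂ) ^ 2 * (X₀ p.2 (p.2 + q) *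
          (klfb_prop (klWdC Λt) (matsubaraFreq β M p.1) (nambuXiCT L μ K p.2) *
            klfb_prop (klPhiC (klScale klE0 j) Λt) (matsubaraFreq β M p.1 + -(2 * π / β)) (nambuXiCT L μ K (p.2 + q)))) := by
      intro p
      simp only [hC]
      rw [klmc_sum_ite_crossed_eq Qm x y p (fun p' => lΦ p' * X₀ p.2 p'.2)]
      by_cases hex : ∃ i₀ : MatsubaraIdx M, matsubaraInt M i₀ + 1 = matsubaraInt M p.1
      · obtain ⟨i₀, hi₀⟩ := hex
        rw [klmc_sum_ite_pred_eq hi₀, hLW p, hLΦ (i₀, p.2 + q)]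
        have hω : matsubaraFreq β M i₀ = matsubaraFreq β M p.1 + -(2 * π / β) := by
          rw [matsubaraFreq_eq_sub_of_matsubaraInt_succ β hi₀]; ring
        simp only [hω]
        ring
      · have hex' : ∀ i' : MatsubaraIdx M, matsubaraInt M i' + 1 ≠ matsubaraInt M p.1 := fun i' h => hex ⟨i', h⟩
        rw [klmc_sum_ite_pred_eq_zero hex', hLW p, hLW0 p (klmc_sq_gt_of_val_eq_zero hβ hΛ1.le hM p.1 (klmc_val_eq_zero_of_no_pred hex'))]
        simp
    -- term A: source collapse to the frequency one above
    have hA : ∀ p' : FreqMomentum L M, lW p' * (∑ p : FreqMomentum L M, if C p p' then lΦ p * X₀ p.2 p'.2 else 0) =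
        (((β * (L : ℝ) ^ 2 : ℝ)) : ℂ) ^ 2 * (X₀ (p'.2 + -q) p'.2 *
          (klfb_prop (klWdC Λt) (matsubaraFreq β M p'.1) (nambuXiCT L μ K p'.2) *
            klfb_prop (klPhiC (klScale klE0 j) Λt) (matsubaraFreq β M p'.1 + 2 * π / β) (nambuXiCT L μ K (p'.2 + -q)))) := by
      intro p'
      simp only [hC]
      rw [klmc_sum_ite_crossed_eq' Qm x y p' (fun p => lΦ p * X₀ p.2 p'.2)]
      by_cases hex : ∃ i₀ : MatsubaraIdx M, matsubaraInt M p'.1 + 1 = matsubaraInt M i₀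
      · obtain ⟨i₀, hi₀⟩ := hex
        rw [klmc_sum_ite_succ_eq hi₀, hLW p', hLΦ (i₀, p'.2 + -q)]
        have hω : matsubaraFreq β M i₀ = matsubaraFreq β M p'.1 + 2 * π / β := by
          have := matsubaraFreq_eq_sub_of_matsubaraInt_succ β hi₀; linarith
        simp only [hω]
        ring
      · have hex' : ∀ i : MatsubaraIdx M, matsubaraInt M p'.1 + 1 ≠ matsubaraInt M i := fun i h => hex ⟨i, h⟩
        have hzero : (∑ i : MatsubaraIdx M, if matsubaraInt M p'.1 + 1 = matsubaraInt M i then lΦ (i, p'.2 + -(Qm - x - y)) * X₀ (i, p'.2 + -(Qm - x - y)).2 p'.2 else 0) = 0 :=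
          Finset.sum_eq_zero fun i _ => by rw [if_neg (hex' i)]
        rw [hzero, hLW p', hLW0 p' (klmc_sq_gt_of_val_eq_top hβ hΛ1.le hM p'.1 (klmc_val_eq_top_of_no_succ hex'))]
        simp
    rw [Finset.sum_congr rfl fun p _ => hB p, Finset.sum_congr rfl fun p' _ => hA p', ← Finset.mul_sum, ← Finset.mul_sum]
    have hnorm : ‖(((β * (L : ℝ) ^ 2 : ℝ)) : ℂ) ^ 2‖ = (β * (L : ℝ) ^ 2) ^ 2 := by
      rw [norm_pow, Complex.norm_real, Real.norm_of_nonneg (by positivity)]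
    refine (norm_add_le _ _).trans ?_
    rw [norm_mul, norm_mul, hnorm, ← mul_add]
  · ----------------------------------------------------------------- the flat remainder
    have h2πβ : 2 * π / β ≤ klScale klE0 (n + 1) / 8 := by
      have : 2 * π / β = (16 * π / β) / 8 := by ring
      rw [this]; exact div_le_div_of_nonneg_right hβn (by norm_num)
    have hterm : ∀ (p p' : FreqMomentum L M),
        ‖(if C p p' then ln p p' * (X p p' - X₀ p.2 p'.2) else 0)‖ ≤ ε * (if C p p' then ‖ln p p'‖ else 0) := by
      intro p p'
      simp only [hC]
      split_ifs with hc
      · obtain ⟨hω, hk⟩ := (klmc_constraint_iff Qm x y p p').1 hc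
        have hωrel : matsubaraFreq β M p'.1 = matsubaraFreq β M p.1 - 2 * π / β := matsubaraFreq_eq_sub_of_matsubaraInt_succ β hω
        by_cases hwin : matsubaraFreq β M p.1 ^ 2 ≤ (5 * klScale klE0 (n + 1)) ^ 2
        · rw [norm_mul, mul_comm]
          refine mul_le_mul_of_nonneg_right ?_ (norm_nonneg _)
          have h := hflat p.1 p'.1 p.2 p'.2 hω hwin
          simp only [hX, hX₀]
          exact h
        · -- outside the `5Λ` window both slice factors vanish
          have hω5 : (5 * klScale klE0 (n + 1)) ^ 2 < matsubaraFreq β M p.1 ^ 2 := not_le.mp hwin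
          have hωp : (4 * klScale klE0 (n + 1)) ^ 2 < matsubaraFreq β M p.1 ^ 2 := lt_of_le_of_lt (by nlinarith [hΛ1]) hω5
          have hωp' : (4 * klScale klE0 (n + 1)) ^ 2 < matsubaraFreq β M p'.1 ^ 2 := by
            by_contra hle
            have hle' : matsubaraFreq β M p'.1 ^ 2 ≤ (4 * klScale klE0 (n + 1)) ^ 2 := not_lt.mp hle
            have habs : |matsubaraFreq β M p'.1| ≤ 4 * klScale klE0 (n + 1) := abs_le_of_sq_le_sq' hle' (by positivity) |>.2 |> fun h => by
              exact abs_le.2 ⟨(abs_le_of_sq_le_sq' hle' (by positivity)).1, h⟩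
            have habs_p : |matsubaraFreq β M p.1| ≤ 5 * klScale klE0 (n + 1) := by
              have e : matsubaraFreq β M p.1 = matsubaraFreq β M p'.1 + 2 * π / β := by rw [hωrel]; ring
              rw [e]
              refine (abs_add_le _ _).trans ?_
              rw [abs_of_pos (by positivity : (0:ℝ) < 2 * π / β)]
              linarith
            have hsq : matsubaraFreq β M p.1 ^ 2 ≤ (5 * klScale klE0 (n + 1)) ^ 2 := by
              rw [← sq_abs]; exact pow_le_pow_left₀ (abs_nonneg _) habs_p 2
            exact absurd hsq hwin
          have hz : Wd t p = 0 := by simp only [hWd]; exact klms_Wd_eq_zero_of_freq β μ K n hlo hhi p hωp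
          have hz' : Wd t p' = 0 := by simp only [hWd]; exact klms_Wd_eq_zero_of_freq β μ K n hlo hhi p' hωp'
          have hln0 : ln p p' = 0 := by simp only [hln, hlW, hz, hz']; simp
          rw [hln0]
          simp
      · simp
    calc ‖∑ p : FreqMomentum L M, ∑ p' : FreqMomentum L M, (if C p p' then ln p p' * (X p p' - X₀ p.2 p'.2) else 0)‖
        ≤ ∑ p : FreqMomentum L M, ∑ p' : FreqMomentum L M, ε * (if C p p' then ‖ln p p'‖ else 0) :=
          (norm_sum_le _ _).trans (Finset.sum_le_sum fun p _ => (norm_sum_le _ _).trans (Finset.sum_le_sum fun p' _ => hterm p p'))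
      _ = ε * ∑ p : FreqMomentum L M, ∑ p' : FreqMomentum L M, (if C p p' then ‖ln p p'‖ else 0) := by simp only [Finset.mul_sum]
      _ ≤ ε * (256 / 3 * (β * (L : ℝ) ^ 2) ^ 2 / Λt ^ 2 * ∑ p : FreqMomentum L M, |Φ j t p| * ‖propCT L M β μ K p‖) := by
          refine mul_le_mul_of_nonneg_left ?_ hε
          have h := crossed_mass_le_softSum β μ K hβ hΛpos (Φ j t) Qm x y
          subst hWd
          simpa only [hC, hln, hlW, hlΦ, hG] using h

end Summit.HubbardSuperconductivity.HubbardSuperconductivity.Theorems.KLRegimeSplit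

end
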